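import Summits.ResolutionOfSingularities.ResolutionOfSingularities.Theorems.FrobeniusClosingPatchingRelPerfectConeCubeTools
import Summits.ResolutionOfSingularities.ResolutionOfSingularities.Theorems.FrobeniusClosingPatchingRelPerfectConeDepthTwoCharts
import HarnessLib

/-!
# Crux `PatchingRelPerfect` (stmt-ResolutionOfSingularities-16161), chain w52 — the
# CONTACT-MIGRATION member `I = (x₀x₁ + x₂² + x₃³) + 𝔪⁴`: level-two chart ideals (the vertex
# blow-up)

[OURS · L1 W5.2 · rung] PLAN-A2-certificate.md addendum 5 step (2).  Abstract setting of
`…ConeDepthTwoCharts` §LevelTwo: `A` a ring (it will be the vertex chart `B₃` of `Bl_𝔪`),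
`c = (t, v₀, v₁, v₂)`, `F = v₀v₁ + v₂²`, and the strict transform `z = F + t` of the member.  On
`B₃` the five companion factors and `I` of `…ConeCubeCharts` read
`M_{k,m} = (z) + (t)ᵏ N^m`, `N = (t, v₀, v₁, v₂)`, `(k, m) ∈ {(2,0), (0,2), (1,0), (1,1), (1,2)}`.
On the chart `C_j` of `Bl_N Spec A` (exceptional parameter `w`, `u' = e'₀`,
`G = e'₁e'₂ + e'₃²`, `ψ z = w · c` with `c = u' + w G`) we PROVE the exact images

* `map_chartBase_cube20/02/10/11/12` — `M_{k,m} C_j = (w) · (c, w^{2k+m-1} Gᵏ)`;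
* `map_chartBase_cubePi` — `Π C_j = (w⁵) · ∏_{s<5} (c, L₀ ⋯ L_s)` with the letter word
  `L = (w, G, w, w, G)` — the flag `(c,w)(c,wG)(c,w²G)(c,w³G)(c,w³G²)` of `…LetterTower`;
* `map_chartBase_cubePi_zero` — on the `t`-chart everything is Cartier: `Π C₀ = (w)⁵`.

Generic algebra: `flag_five_eq`, `cube_flag_product`, `map_span_sup_pow_mul_pow_flag`,
`map_span_sup_of_unit`.  Arbitrary commutative rings; nothing here is a statement of the manuscript
under review.

## References

* The Stacks Project, Tags 0804, 080B. [StacksProject]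
* U. Görtz, T. Wedhorn, *Algebraic Geometry I*, 2nd ed. 2020, Prop. 13.91 (2), (13.19). [GortzWedhorn2020]
-/

-- `Summit.<Summit>.<Sub>.Theorems` with `Sub = Summit` (single-conjunct summit, D-0017)
set_option linter.dupNamespace false

noncomputable section

open CategoryTheory CategoryTheory.Limits AlgebraicGeometry Literature.AlgebraicGeometry.Resolution
open IsLocalRing

namespace Summit.ResolutionOfSingularities.ResolutionOfSingularities.Theorems

namespace ConeRung

universe u

/-! ## Generic algebra of the five-step flag -/

section Generic

variable {R B : Type*} [CommRing R] [CommRing B]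

/-- The flag of the letter word `(a, b, a, a, b)`:
`∏_{s<5} (c, L₀⋯L_s) = (c, a)(c, ab)(c, a²b)(c, a³b)(c, a³b²)`. [folklore] -/
theorem flag_five_eq (c a b : B) :
    ∏ s ∈ Finset.range 5, Ideal.span {c, ∏ r ∈ Finset.range (s + 1), [a, b, a, a, b].getD r 1} =
      Ideal.span {c, a} * Ideal.span {c, a * b} * Ideal.span {c, a ^ 2 * b} *
        Ideal.span {c, a ^ 3 * b} * Ideal.span {c, a ^ 3 * b ^ 2} := by
  have e4 : a * b * a * a * b = a ^ 3 * b ^ 2 := by ring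
  have e3 : a * b * a * a = a ^ 3 * b := by ring
  have e2 : a * b * a = a ^ 2 * b := by ring
  simp only [Finset.prod_range_succ, Finset.prod_range_zero, List.getD_cons_zero,
    List.getD_cons_succ, one_mul]
  rw [e4, e3, e2]

/-- The letter word `(a, b, a, a, b, 1, 1, …)` takes values in `{a, b, 1}`. [folklore] -/
theorem cube_letters₂_spec (a b : B) (r : ℕ) :
    [a, b, a, a, b].getD r 1 = a ∨ [a, b, a, a, b].getD r 1 = b ∨ [a, b, a, a, b].getD r 1 = 1 := by
  rcases r with _ | _ | _ | _ | _ | r <;> simp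

/-- Reordering the five twisted factors. [folklore] -/
theorem cube_flag_product (W X20 X02 X10 X11 X12 : Ideal B) :
    W * X20 * (W * X02) * (W * X10) * (W * X11) * (W * X12) =
      W ^ 5 * (X02 * X10 * X11 * X12 * X20) := by
  ring

/-- **The `e`-charts, flag form**: `ψ z = w (u' + w h)`, `ψ u = w u'`, `ψ(𝔫) = (w)` ⇒
`ψ((z) + uᵏ 𝔫ᵐ) = (w) · (u' + w h, w^{2k+m-1} hᵏ)` for `k + m ≥ 1`. [cite: StacksProject, Tag 080B] -/
theorem map_span_sup_pow_mul_pow_flag (ψ : R →+* B) (z u : R) (𝔫 : Ideal R) (w u' h : B)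
    (hz : ψ z = w * (u' + w * h)) (hu : ψ u = w * u') (h𝔫 : 𝔫.map ψ = Ideal.span {w}) (k m : ℕ)
    (hkm : 1 ≤ k + m) :
    (Ideal.span {z} ⊔ Ideal.span {u} ^ k * 𝔫 ^ m).map ψ =
      Ideal.span {w} * Ideal.span {u' + w * h, w ^ (2 * k + m - 1) * h ^ k} := by
  rw [map_span_sup_pow_mul_pow ψ z u 𝔫 w (u' + w * h) u' hz hu h𝔫 k m hkm]
  have h1 := span_pair_flag (u' + w * h) w h k (k + m - 1)
  rw [add_sub_cancel_right, show k + (k + m - 1) = 2 * k + m - 1 by omega] at h1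
  rw [h1]

/-- **The `u`-chart**: if `ψ z = w (1 + w q)` and `ψ(J) = (w)ᵉ`, `e ≥ 1`, then `ψ((z) + J) = (w)`.
[cite: StacksProject, Tag 080B] -/
theorem map_span_sup_of_unit (ψ : R →+* B) (z : R) (J : Ideal R) (w q : B)
    (hz : ψ z = w * (1 + w * q)) (e : ℕ) (he : 1 ≤ e) (hJ : J.map ψ = Ideal.span {w} ^ e) :
    (Ideal.span {z} ⊔ J).map ψ = Ideal.span {w} := by
  rw [Ideal.map_sup, Ideal.map_span ψ {z}, Set.image_singleton, hz, hJ, Ideal.span_singleton_pow,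
    ← Ideal.span_insert]
  exact span_pair_one_add_mul w q e he

variable (ψ : R →+* B) (z u : R) (𝔫 : Ideal R) (w u' h : B)
  (hz : ψ z = w * (u' + w * h)) (hu : ψ u = w * u') (h𝔫 : 𝔫.map ψ = Ideal.span {w})

include hz hu h𝔫

/-- `ψ((z) + (u)²) = (w) · (u' + w h, w³ h²)`. [folklore] -/
theorem map_cube20 : (Ideal.span {z} ⊔ Ideal.span {u} ^ 2).map ψ =
    Ideal.span {w} * Ideal.span {u' + w * h, w ^ 3 * h ^ 2} := by
  have h1 := map_span_sup_pow_mul_pow_flag ψ z u 𝔫 w u' h hz hu h𝔫 2 0 (by norm_num)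
  rwa [pow_zero, mul_one] at h1

/-- `ψ((z) + 𝔫²) = (w) · (u' + w h, w)`. [folklore] -/
theorem map_cube02 : (Ideal.span {z} ⊔ 𝔫 ^ 2).map ψ =
    Ideal.span {w} * Ideal.span {u' + w * h, w} := by
  have h1 := map_span_sup_pow_mul_pow_flag ψ z u 𝔫 w u' h hz hu h𝔫 0 2 (by norm_num)
  rwa [pow_zero, one_mul, pow_zero, mul_one, pow_one] at h1

/-- `ψ((z) + (u)) = (w) · (u' + w h, w h)`. [folklore] -/
theorem map_cube10 : (Ideal.span {z} ⊔ Ideal.span {u}).map ψ =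
    Ideal.span {w} * Ideal.span {u' + w * h, w * h} := by
  have h1 := map_span_sup_pow_mul_pow_flag ψ z u 𝔫 w u' h hz hu h𝔫 1 0 (by norm_num)
  rwa [pow_zero, mul_one, pow_one, pow_one, pow_one] at h1

/-- `ψ((z) + (u) 𝔫) = (w) · (u' + w h, w² h)`. [folklore] -/
theorem map_cube11 : (Ideal.span {z} ⊔ Ideal.span {u} * 𝔫).map ψ =
    Ideal.span {w} * Ideal.span {u' + w * h, w ^ 2 * h} := by
  have h1 := map_span_sup_pow_mul_pow_flag ψ z u 𝔫 w u' h hz hu h𝔫 1 1 (by norm_num)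
  rwa [pow_one, pow_one, pow_one] at h1

/-- `ψ((z) + (u) 𝔫²) = (w) · (u' + w h, w³ h)`. [folklore] -/
theorem map_cube12 : (Ideal.span {z} ⊔ Ideal.span {u} * 𝔫 ^ 2).map ψ =
    Ideal.span {w} * Ideal.span {u' + w * h, w ^ 3 * h} := by
  have h1 := map_span_sup_pow_mul_pow_flag ψ z u 𝔫 w u' h hz hu h𝔫 1 2 (by norm_num)
  rwa [pow_one, pow_one] at h1

/-- **The product of the five factors in flag form**: `ψ(Π) = (w⁵) · ∏_{s<5} (c, L₀⋯L_s)` with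
`c = u' + w h` and letters `(w, h, w, w, h)`. [folklore] -/
theorem map_cubePi :
    ((Ideal.span {z} ⊔ Ideal.span {u} ^ 2) * (Ideal.span {z} ⊔ 𝔫 ^ 2) *
        (Ideal.span {z} ⊔ Ideal.span {u}) * (Ideal.span {z} ⊔ Ideal.span {u} * 𝔫) *
        (Ideal.span {z} ⊔ Ideal.span {u} * 𝔫 ^ 2)).map ψ =
      Ideal.span {w ^ 5} *
        ∏ s ∈ Finset.range 5, Ideal.span {u' + w * h,
          ∏ r ∈ Finset.range (s + 1), [w, h, w, w, h].getD r 1} := by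
  rw [Ideal.map_mul, Ideal.map_mul, Ideal.map_mul, Ideal.map_mul, map_cube20 ψ z u 𝔫 w u' h hz hu h𝔫,
    map_cube02 ψ z u 𝔫 w u' h hz hu h𝔫, map_cube10 ψ z u 𝔫 w u' h hz hu h𝔫,
    map_cube11 ψ z u 𝔫 w u' h hz hu h𝔫, map_cube12 ψ z u 𝔫 w u' h hz hu h𝔫, cube_flag_product,
    ← Ideal.span_singleton_pow, flag_five_eq]

end Generic

/-! ## Level two: the images on the charts of the vertex blow-up `Bl_{(t, v₀, v₁, v₂)}` -/

section LevelTwo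

variable {A : Type u} [CommRing A] (t : A) (v : Fin 3 → A) (j : Fin 4)

local notation3 "cc" => (Fin.cons t v : Fin 4 → A)
local notation3 "F" => v 0 * v 1 + v 2 ^ 2
local notation3 "zC" => v 0 * v 1 + v 2 ^ 2 + t
local notation3 "N" => Ideal.span {t, v 0, v 1, v 2}
local notation3 "Tt" => Ideal.span {t}
/-- the five companion factors `M₂₀ M₀₂ M₁₀ M₁₁ M₁₂` of the member at the vertex chart -/
local notation3 "cubePi" =>
  (Ideal.span {v 0 * v 1 + v 2 ^ 2 + t} ⊔ Ideal.span {t} ^ 2) *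
    (Ideal.span {v 0 * v 1 + v 2 ^ 2 + t} ⊔ Ideal.span {t, v 0, v 1, v 2} ^ 2) *
    (Ideal.span {v 0 * v 1 + v 2 ^ 2 + t} ⊔ Ideal.span {t}) *
    (Ideal.span {v 0 * v 1 + v 2 ^ 2 + t} ⊔ Ideal.span {t} * Ideal.span {t, v 0, v 1, v 2}) *
    (Ideal.span {v 0 * v 1 + v 2 ^ 2 + t} ⊔ Ideal.span {t} * Ideal.span {t, v 0, v 1, v 2} ^ 2)
local notation3 "C" => chartRing cc j
local notation3 "ψ" => chartBase cc j
local notation3 "w" => chartBase cc j (cc j)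
local notation3 "e'[" l "]" => chartGen cc j l
local notation3 "G" => chartGen cc j 1 * chartGen cc j 2 + chartGen cc j 3 ^ 2

/-- **`ψ(z) = w · (u' + w G)`** on every chart of `Bl_N` (`ψ F = w² G`, `ψ t = w u'`). [folklore] -/
theorem chartBase_zC : ψ zC = w * (e'[0] + w * G) := by
  rw [map_add, chartBase_F_two, chartBase_t_two]
  ring

/-- **The total transform of `Π` on the chart `C_j`**: `(w⁵) · ∏_{s<5} (c, L₀⋯L_s)` with
`c = u' + w G` and letters `(w, G, w, w, G)`. [cite: StacksProject, Tag 080B] -/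
theorem map_chartBase_cubePi :
    (cubePi).map ψ = Ideal.span {w ^ 5} *
      ∏ s ∈ Finset.range 5, Ideal.span {e'[0] + w * G,
        ∏ r ∈ Finset.range (s + 1), [w, G, w, w, G].getD r 1} :=
  map_cubePi ψ zC t N w e'[0] G (chartBase_zC t v j) (chartBase_t_two t v j)
    (map_chartBase_span_t_v t v j)

/-! ### The `t`-chart (`j = 0`, `u' = 1`): everything is Cartier -/

/-- `ψ₀(z) = w (1 + w G)` on the `t`-chart. [folklore] -/
theorem chartBase_zC_zero : chartBase cc 0 zC = chartBase cc 0 (cc 0) *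
    (1 + chartBase cc 0 (cc 0) * (chartGen cc 0 1 * chartGen cc 0 2 + chartGen cc 0 3 ^ 2)) := by
  rw [chartBase_zC, show chartGen cc 0 0 = 1 from chartGen_self cc 0]

/-- `(t) C₀ = (w)`. [folklore] -/
theorem map_chartBase_span_t_zero :
    (Tt).map (chartBase cc 0) = Ideal.span {chartBase cc 0 (cc 0)} := by
  rw [Ideal.map_span (chartBase cc 0) {t}, Set.image_singleton]
  rfl

/-- `M₂₀ C₀ = (w)`. [cite: StacksProject, Tag 080B] -/
theorem map_chartBase_cube20_zero :
    (Ideal.span {zC} ⊔ Tt ^ 2).map (chartBase cc 0) = Ideal.span {chartBase cc 0 (cc 0)} :=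
  map_span_sup_of_unit (chartBase cc 0) zC (Tt ^ 2) _ _ (chartBase_zC_zero t v) 2 (by norm_num)
    (by rw [Ideal.map_pow, map_chartBase_span_t_zero])

/-- `M₀₂ C₀ = (w)`. [cite: StacksProject, Tag 080B] -/
theorem map_chartBase_cube02_zero :
    (Ideal.span {zC} ⊔ N ^ 2).map (chartBase cc 0) = Ideal.span {chartBase cc 0 (cc 0)} :=
  map_span_sup_of_unit (chartBase cc 0) zC (N ^ 2) _ _ (chartBase_zC_zero t v) 2 (by norm_num)
    (by rw [Ideal.map_pow, map_chartBase_span_t_v])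

/-- `M₁₀ C₀ = (w)`. [cite: StacksProject, Tag 080B] -/
theorem map_chartBase_cube10_zero :
    (Ideal.span {zC} ⊔ Tt).map (chartBase cc 0) = Ideal.span {chartBase cc 0 (cc 0)} :=
  map_span_sup_of_unit (chartBase cc 0) zC (Tt) _ _ (chartBase_zC_zero t v) 1 (by norm_num)
    (by rw [map_chartBase_span_t_zero, pow_one])

/-- `M₁₁ C₀ = (w)`. [cite: StacksProject, Tag 080B] -/
theorem map_chartBase_cube11_zero :
    (Ideal.span {zC} ⊔ Tt * N).map (chartBase cc 0) = Ideal.span {chartBase cc 0 (cc 0)} :=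
  map_span_sup_of_unit (chartBase cc 0) zC (Tt * N) _ _ (chartBase_zC_zero t v) 2 (by norm_num)
    (by rw [Ideal.map_mul, map_chartBase_span_t_zero, map_chartBase_span_t_v, sq])

/-- `M₁₂ C₀ = (w)`. [cite: StacksProject, Tag 080B] -/
theorem map_chartBase_cube12_zero :
    (Ideal.span {zC} ⊔ Tt * N ^ 2).map (chartBase cc 0) = Ideal.span {chartBase cc 0 (cc 0)} :=
  map_span_sup_of_unit (chartBase cc 0) zC (Tt * N ^ 2) _ _ (chartBase_zC_zero t v) 3 (by norm_num)
    (by rw [Ideal.map_mul, Ideal.map_pow, map_chartBase_span_t_zero, map_chartBase_span_t_v,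
      pow_succ' (Ideal.span {chartBase cc 0 (cc 0)}) 2])

/-- **On the `t`-chart everything is Cartier**: `Π C₀ = (w)⁵`. [cite: StacksProject, Tag 080B] -/
theorem map_chartBase_cubePi_zero :
    (cubePi).map (chartBase cc 0) = Ideal.span {chartBase cc 0 (cc 0)} ^ 5 := by
  -- (`simp only`, not `rw`: `rw [Ideal.map_mul]` tries to unify `(z) + …` with a product, which is
  -- prohibitively slow in the chart ring)
  simp only [Ideal.map_mul, map_chartBase_cube20_zero, map_chartBase_cube02_zero,
    map_chartBase_cube10_zero, map_chartBase_cube11_zero, map_chartBase_cube12_zero]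
  rw [pow_succ (Ideal.span {chartBase cc 0 (cc 0)}) 4,
    pow_succ (Ideal.span {chartBase cc 0 (cc 0)}) 3, pow_succ (Ideal.span {chartBase cc 0 (cc 0)}) 2,
    pow_succ (Ideal.span {chartBase cc 0 (cc 0)}) 1, pow_one]

end LevelTwo

end ConeRung

end Summit.ResolutionOfSingularities.ResolutionOfSingularities.Theorems

end
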